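import Summits.AtomisticToContinuum.Crystallization.Theorems.ExcessDecayLiouvilleCaccioppoliBound

/-!
# Route `ExcessDecayLiouville`: the LOCALISED Caccioppoli bound — weights and termwise majorant

Refinement of `abs_cutoffForm_le` (file `ExcessDecayLiouvilleCaccioppoliBound.lean`) needed to ITERATE the Caccioppoli
inequality on difference quotients (step (c2), `k ≥ 2`, of the energy route for item `ExcessDecay`,
stmt-AtomisticToContinuum-9334): the `ℓ²` mass on the right-hand side is localised to the `ρ`-neighbourhood of the
ball carrying the cutoff, at the price of a far-field term.  For a finitely supported displacement `h` with `‖h‖ ≤ B`, a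
cutoff `η` with values in `[0,1]`, slope `1/ρ` between sites (`ρ ≥ 1`) and `η = 0` at the sites with `dist · c > R`:

`|½ Σ'Σ' [p≠q] (η_p − η_q)² ⟪K(p−q) h_p, h_q⟫| ≤ (19·C₆/ρ²) Σ'_p ‖h p‖²·𝟙[dist p c ≤ R+ρ] + 38·(1024/((23/25)³ρ⁵))·B²·#{sites: dist ≤ R}`

(`abs_cutoffForm_le_local`, `C₆ = 1024/(23/25)⁶`): pairs at distance `≤ ρ` are treated with the slope bound (both ends then lie
within `R + ρ` of `c`); pairs at distance `> ρ` with `(η_p − η_q)² ≤ 𝟙_{B_R}(p) + 𝟙_{B_R}(q)`, `|K| ≤ 38|p−q|⁻⁸` and the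
far-field lattice sum `Σ_{|p−q|>ρ} |p−q|⁻⁸ ≤ 1024/((23/25)³ρ⁵)` (`summable_far_inv_pow_eight_sites`).
All `[folklore]`; helper lemmas, nothing here closes an item.
-/

noncomputable section

namespace Summit.AtomisticToContinuum.Crystallization.Theorems.ExcessDecayLiouville

open scoped BigOperators Topology InnerProductSpace RealInnerProductSpace Classical
open Literature.MathematicalPhysics.StatisticalMechanics
open Summit.AtomisticToContinuum.Crystallization.Theorems.PhononStabilityNegative

section

variable {t : Fin 2 → (EuclideanSpace ℝ (Fin 3))} {A : (EuclideanSpace ℝ (Fin 3)) →L[ℝ] (EuclideanSpace ℝ (Fin 3))}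

/-- Far-field lattice sum over the sites: `Σ'_{q : ρ < dist q p} (dist q p)⁻⁸ ≤ 1024/((23/25)³ρ⁵)` for `ρ ≥ 23/25`,
together with summability (the sites are `23/25`-separated). [folklore] -/
theorem summable_far_inv_pow_eight_sites (hA : Adm₀ A) (hI : Inner₀ t A) (p : (EuclideanSpace ℝ (Fin 3)))
    {ρ : ℝ} (hρ : 23 / 25 ≤ ρ) :
    Summable (fun q : Sites₀ t A => if ρ < dist (q : (EuclideanSpace ℝ (Fin 3))) p then (dist (q : (EuclideanSpace ℝ (Fin 3))) p)⁻¹ ^ 8 else 0) ∧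
    ∑' q : Sites₀ t A, (if ρ < dist (q : (EuclideanSpace ℝ (Fin 3))) p then (dist (q : (EuclideanSpace ℝ (Fin 3))) p)⁻¹ ^ 8 else 0) ≤
      1024 / ((23 / 25 : ℝ) ^ 3 * ρ ^ 5) := by
  classical
  have hbound : ∀ u : Finset (Sites₀ t A),
      ∑ q ∈ u, (if ρ < dist (q : (EuclideanSpace ℝ (Fin 3))) p then (dist (q : (EuclideanSpace ℝ (Fin 3))) p)⁻¹ ^ 8 else 0) ≤ 1024 / ((23 / 25 : ℝ) ^ 3 * ρ ^ 5) := by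
    intro u
    have hsum : ∑ q ∈ u, (if ρ < dist (q : (EuclideanSpace ℝ (Fin 3))) p then (dist (q : (EuclideanSpace ℝ (Fin 3))) p)⁻¹ ^ 8 else 0) =
        ∑ a ∈ (u.map (Function.Embedding.subtype _)).filter (fun a => ρ < dist a p), (dist a p)⁻¹ ^ (5 + 3) := by
      rw [Finset.sum_filter, Finset.sum_map]
      rfl
    rw [hsum]
    refine sum_inv_pow_le_of_separated _ p (by norm_num) (by norm_num : (0 : ℝ) < 23 / 25) hρ ?_ ?_
    · intro a ha b hb hab
      simp only [Finset.mem_filter, Finset.mem_map, Function.Embedding.coe_subtype] at ha hb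
      obtain ⟨⟨a', -, rfl⟩, -⟩ := ha
      obtain ⟨⟨b', -, rfl⟩, -⟩ := hb
      exact dist_sites_ge hA hI a'.2 b'.2 hab
    · intro a ha
      simp only [Finset.mem_filter, Finset.mem_map, Function.Embedding.coe_subtype] at ha
      exact ha.2.le
  exact ⟨summable_of_sum_le (fun q => by split_ifs <;> positivity) hbound,
    Real.tsum_le_of_sum_le (fun q => by split_ifs <;> positivity) hbound⟩

/-- The localised near-weight family `[p≠q] |p−q|⁻⁶ ‖h q‖² 𝟙[dist q c ≤ R+ρ]` is summable on `S × S`. [folklore] -/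
theorem summable_nearWeight (hA : Adm₀ A) (hI : Inner₀ t A) {h : (EuclideanSpace ℝ (Fin 3)) → (EuclideanSpace ℝ (Fin 3))}
    (hh : (Function.support h).Finite) (c : (EuclideanSpace ℝ (Fin 3))) (R ρ : ℝ) :
    Summable (Function.uncurry fun (p q : Sites₀ t A) => (if (p : (EuclideanSpace ℝ (Fin 3))) ≠ q then (dist (p : (EuclideanSpace ℝ (Fin 3))) q)⁻¹ ^ 6 * (‖h q‖ ^ 2 * (if dist (q : (EuclideanSpace ℝ (Fin 3))) c ≤ R + ρ then (1 : ℝ) else 0)) else 0)) := by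
  classical
  have hW := summable_weightFamily hA hI hh
  have hWu : Summable (Function.uncurry fun (p q : Sites₀ t A) =>
      (if (p : (EuclideanSpace ℝ (Fin 3))) ≠ q then (dist (p : (EuclideanSpace ℝ (Fin 3))) q)⁻¹ ^ 6 * ‖h q‖ ^ 2 else 0)) := hW
  refine Summable.of_nonneg_of_le (fun pq => ?_) (fun pq => ?_) hWu
  · obtain ⟨p, q⟩ := pq
    simp only [Function.uncurry_apply_pair]
    split_ifs <;> positivity
  · obtain ⟨p, q⟩ := pq
    simp only [Function.uncurry_apply_pair]
    by_cases hpq : (p : (EuclideanSpace ℝ (Fin 3))) = q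
    · simp [hpq]
    · rw [if_pos hpq, if_pos hpq]
      have h6 : 0 ≤ (dist (p : (EuclideanSpace ℝ (Fin 3))) q)⁻¹ ^ 6 := by positivity
      have hind : ‖h q‖ ^ 2 * (if dist (q : (EuclideanSpace ℝ (Fin 3))) c ≤ R + ρ then (1 : ℝ) else 0) ≤ ‖h q‖ ^ 2 := by
        split_ifs
        · rw [mul_one]
        · rw [mul_zero]; positivity
      exact mul_le_mul_of_nonneg_left hind h6

/-- The far-weight family `[p≠q] [ρ < |p−q|] |p−q|⁻⁸ 𝟙[dist p c ≤ R]` is summable on `S × S` (finitely many nonzero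
rows, each a far-field lattice sum). [folklore] -/
theorem summable_farWeight (hA : Adm₀ A) (hI : Inner₀ t A) (c : (EuclideanSpace ℝ (Fin 3))) (R : ℝ) {ρ : ℝ} (hρ : 23 / 25 ≤ ρ) :
    Summable (Function.uncurry fun (p q : Sites₀ t A) => (if (p : (EuclideanSpace ℝ (Fin 3))) ≠ q then (if ρ < dist (p : (EuclideanSpace ℝ (Fin 3))) q then (dist (p : (EuclideanSpace ℝ (Fin 3))) q)⁻¹ ^ 8 else 0) * (if dist (p : (EuclideanSpace ℝ (Fin 3))) c ≤ R then (1 : ℝ) else 0) else 0)) := by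
  classical
  set BR := (finite_sites_dist_le hA hI c R).toFinset with hBR
  have hmemBR : ∀ x, x ∈ BR ↔ x ∈ Sites₀ t A ∧ dist x c ≤ R := fun x => by
    simp only [hBR, Set.Finite.mem_toFinset, Set.mem_setOf_eq]
  rw [summable_prod_of_nonneg (fun pq => by
    obtain ⟨p, q⟩ := pq
    simp only [Function.uncurry_apply_pair]
    split_ifs <;> positivity)]
  constructor
  · intro p
    by_cases hpB : dist (p : (EuclideanSpace ℝ (Fin 3))) c ≤ R
    · have hs := (summable_far_inv_pow_eight_sites hA hI (p : (EuclideanSpace ℝ (Fin 3))) hρ).1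
      refine Summable.of_nonneg_of_le (fun q => ?_) (fun q => ?_) hs
      · simp only [Function.uncurry_apply_pair]; split_ifs <;> positivity
      · simp only [Function.uncurry_apply_pair]
        by_cases hpq : (p : (EuclideanSpace ℝ (Fin 3))) = q
        · simp [hpq]
        · rw [if_pos hpq, if_pos hpB, mul_one, dist_comm (q : (EuclideanSpace ℝ (Fin 3))) p]
    · have hz : ∀ q : Sites₀ t A, (Function.uncurry (fun (p q : Sites₀ t A) => (if (p : (EuclideanSpace ℝ (Fin 3))) ≠ q then (if ρ < dist (p : (EuclideanSpace ℝ (Fin 3))) q then (dist (p : (EuclideanSpace ℝ (Fin 3))) q)⁻¹ ^ 8 else 0) * (if dist (p : (EuclideanSpace ℝ (Fin 3))) c ≤ R then (1 : ℝ) else 0) else 0))) (p, q) = 0 := by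
        intro q
        simp only [Function.uncurry_apply_pair, if_neg hpB, mul_zero, ite_self]
      exact summable_zero.congr fun q => (hz q).symm
  · have hfin : Set.Finite {p : Sites₀ t A | dist (p : (EuclideanSpace ℝ (Fin 3))) c ≤ R} :=
      ((finite_sites_dist_le hA hI c R).preimage Subtype.val_injective.injOn).subset fun p hp => ⟨p.2, hp⟩
    refine summable_of_ne_finset_zero (s := hfin.toFinset) ?_
    intro p hp
    have hpB : ¬ dist (p : (EuclideanSpace ℝ (Fin 3))) c ≤ R := fun h' => hp ((Set.Finite.mem_toFinset _).2 h')
    have hz : ∀ q : Sites₀ t A, (Function.uncurry (fun (p q : Sites₀ t A) => (if (p : (EuclideanSpace ℝ (Fin 3))) ≠ q then (if ρ < dist (p : (EuclideanSpace ℝ (Fin 3))) q then (dist (p : (EuclideanSpace ℝ (Fin 3))) q)⁻¹ ^ 8 else 0) * (if dist (p : (EuclideanSpace ℝ (Fin 3))) c ≤ R then (1 : ℝ) else 0) else 0))) (p, q) = 0 := by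
      intro q
      simp only [Function.uncurry_apply_pair, if_neg hpB, mul_zero, ite_self]
    simp only [hz, tsum_zero]

/-- `Σ'` of the indicator of a ball over the sites is bounded by the packing number `(2R/(23/25) + 1)³`. [folklore] -/
theorem tsum_indicator_ball_sites_le (hA : Adm₀ A) (hI : Inner₀ t A) (c : (EuclideanSpace ℝ (Fin 3))) {R : ℝ} (hR : 0 ≤ R) :
    Summable (fun p : Sites₀ t A => (if dist (p : (EuclideanSpace ℝ (Fin 3))) c ≤ R then (1 : ℝ) else 0)) ∧
    ∑' p : Sites₀ t A, (if dist (p : (EuclideanSpace ℝ (Fin 3))) c ≤ R then (1 : ℝ) else 0) ≤ (2 * R / (23 / 25) + 1) ^ 3 := by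
  classical
  have hbound : ∀ u : Finset (Sites₀ t A), ∑ p ∈ u, (if dist (p : (EuclideanSpace ℝ (Fin 3))) c ≤ R then (1 : ℝ) else 0) ≤ (2 * R / (23 / 25) + 1) ^ 3 := by
    intro u
    rw [← Finset.sum_filter]
    simp only [Finset.sum_const, nsmul_eq_mul, mul_one]
    set v := (u.filter fun p : Sites₀ t A => dist (p : (EuclideanSpace ℝ (Fin 3))) c ≤ R).map (Function.Embedding.subtype _) with hv
    have hcard : ((u.filter fun p : Sites₀ t A => dist (p : (EuclideanSpace ℝ (Fin 3))) c ≤ R).card : ℝ) = v.card := by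
      rw [hv, Finset.card_map]
    rw [hcard]
    have h := card_le_of_separated_of_dist_le v c (by norm_num : (0 : ℝ) < 23 / 25) hR ?_ ?_
    · rwa [finrank_euclideanSpace_fin] at h
    · intro a ha
      simp only [hv, Finset.mem_map, Finset.mem_filter, Function.Embedding.coe_subtype] at ha
      obtain ⟨a', ⟨-, ha'⟩, rfl⟩ := ha
      exact ha'
    · intro a ha b hb hab
      simp only [hv, Finset.mem_map, Finset.mem_filter, Function.Embedding.coe_subtype] at ha hb
      obtain ⟨a', -, rfl⟩ := ha
      obtain ⟨b', -, rfl⟩ := hb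
      exact dist_sites_ge hA hI a'.2 b'.2 hab
  exact ⟨summable_of_sum_le (fun p => by split_ifs <;> norm_num) hbound,
    Real.tsum_le_of_sum_le (fun p => by split_ifs <;> norm_num) hbound⟩

/-- Termwise bound for the localised Caccioppoli estimate: each pair term is dominated by the near majorant
(slope bound, both ends within `R + ρ`) plus the far majorant (`(η_p−η_q)² ≤ 𝟙_B(p) + 𝟙_B(q)`). [folklore] -/
theorem cutoffTerm_le_local (hA : Adm₀ A) (hI : Inner₀ t A) {h : (EuclideanSpace ℝ (Fin 3)) → (EuclideanSpace ℝ (Fin 3))} {B : ℝ} (hB : ∀ x, ‖h x‖ ≤ B)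
    {η : (EuclideanSpace ℝ (Fin 3)) → ℝ} (hη0 : ∀ x, 0 ≤ η x) (hη1 : ∀ x, η x ≤ 1)
    {c : (EuclideanSpace ℝ (Fin 3))} {R ρ : ℝ} (hρ : 1 ≤ ρ)
    (hηR : ∀ p : Sites₀ t A, R < dist (p : (EuclideanSpace ℝ (Fin 3))) c → η p = 0)
    (hlip : ∀ p q : Sites₀ t A, |η p - η q| ≤ ‖(p : (EuclideanSpace ℝ (Fin 3))) - q‖ / ρ) (p q : Sites₀ t A) :
    |(if (p : (EuclideanSpace ℝ (Fin 3))) ≠ q then (η p - η q) ^ 2 * ⟪((-((‖(p : (EuclideanSpace ℝ (Fin 3))) - q‖ ^ 2)⁻¹) ^ 7 + ((‖(p : (EuclideanSpace ℝ (Fin 3))) - q‖ ^ 2)⁻¹) ^ 4) • (h p) + (2 * ⟪(p : (EuclideanSpace ℝ (Fin 3))) - q, h p⟫ * (7 * ((‖(p : (EuclideanSpace ℝ (Fin 3))) - q‖ ^ 2)⁻¹) ^ 8 - 4 * ((‖(p : (EuclideanSpace ℝ (Fin 3))) - q‖ ^ 2)⁻¹) ^ 5)) • ((p : (EuclideanSpace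 ℝ (Fin 3))) - q)), h q⟫ else 0)| ≤ 19 / ρ ^ 2 * ((if (p : (EuclideanSpace ℝ (Fin 3))) ≠ q then (dist (p : (EuclideanSpace ℝ (Fin 3))) q)⁻¹ ^ 6 * (‖h q‖ ^ 2 * (if dist (q : (EuclideanSpace ℝ (Fin 3))) c ≤ R + ρ then (1 : ℝ) else 0)) else 0) + (if (q : (EuclideanSpace ℝ (Fin 3))) ≠ p then (dist (q : (EuclideanSpace ℝ (Fin 3))) p)⁻¹ ^ 6 * (‖h p‖ ^ 2 * (if dist (p : (EuclideanSpace ℝ (Fin 3))) c ≤ R + ρ then (1 : ℝ) else 0)) else 0)) + 38 * B ^ 2 * ((if (p : (EuclideanSpace ℝ (Fin 3))) ≠ q then (if ρ < dist (p : (EuclideanSpace ℝ (Fin 3))) q then (dist (p : (EuclideanSpace ℝ (Fin 3))) q)⁻¹ ^ 8 else 0) * (if dist (p : (EuclideanSpace ℝ (Fin 3))) c ≤ R then (1 : ℝ) else 0) else 0) + (if (q : (EuclideanSpace ℝ (Fin 3))) ≠ p then (if ρ < dist (q : (EuclideanSpace ℝ (Fin 3))) p then (dist (q : (EuclideanSpace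 ℝ (Fin 3))) p)⁻¹ ^ 8 else 0) * (if dist (q : (EuclideanSpace ℝ (Fin 3))) c ≤ R then (1 : ℝ) else 0) else 0)) := by
  have hB0 : 0 ≤ B := (norm_nonneg _).trans (hB 0)
  have hρ0 : 0 < ρ := by linarith
  by_cases hpq : (p : (EuclideanSpace ℝ (Fin 3))) = q
  · simp [hpq]
  · have hqp : (q : (EuclideanSpace ℝ (Fin 3))) ≠ p := fun h' => hpq h'.symm
    rw [if_pos hpq, if_pos hpq, if_pos hqp, if_pos hpq, if_pos hqp, abs_mul, abs_pow, sq_abs]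
    have hd : (23 / 25 : ℝ) ≤ dist (p : (EuclideanSpace ℝ (Fin 3))) q := dist_sites_ge hA hI p.2 q.2 hpq
    have he : 9 / 10 ≤ ‖(p : (EuclideanSpace ℝ (Fin 3))) - q‖ := by rw [← dist_eq_norm]; linarith
    have hdpos : 0 < dist (p : (EuclideanSpace ℝ (Fin 3))) q := by linarith
    set d := dist (p : (EuclideanSpace ℝ (Fin 3))) q with hdd
    have hnd : ‖(p : (EuclideanSpace ℝ (Fin 3))) - q‖ = d := by rw [hdd, dist_eq_norm]
    have hdqp : dist (q : (EuclideanSpace ℝ (Fin 3))) p = d := by rw [hdd, dist_comm]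
    rw [hdqp]
    have hin : |⟪((-((‖(p : (EuclideanSpace ℝ (Fin 3))) - q‖ ^ 2)⁻¹) ^ 7 + ((‖(p : (EuclideanSpace ℝ (Fin 3))) - q‖ ^ 2)⁻¹) ^ 4) • (h p) + (2 * ⟪(p : (EuclideanSpace ℝ (Fin 3))) - q, h p⟫ * (7 * ((‖(p : (EuclideanSpace ℝ (Fin 3))) - q‖ ^ 2)⁻¹) ^ 8 - 4 * ((‖(p : (EuclideanSpace ℝ (Fin 3))) - q‖ ^ 2)⁻¹) ^ 5)) • ((p : (EuclideanSpace ℝ (Fin 3))) - q)), h q⟫| ≤ 38 * (d⁻¹) ^ 8 * ‖h p‖ * ‖h q‖ := by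
      have := (abs_real_inner_le_norm _ _).trans
        (mul_le_mul_of_nonneg_right (norm_forceConst_apply_le he (h p)) (norm_nonneg (h q)))
      rw [hnd] at this
      exact this
    have hnear0 : 0 ≤ 19 / ρ ^ 2 * ((d⁻¹) ^ 6 * (‖h q‖ ^ 2 * (if dist (q : (EuclideanSpace ℝ (Fin 3))) c ≤ R + ρ then (1 : ℝ) else 0)) + (d⁻¹) ^ 6 * (‖h p‖ ^ 2 * (if dist (p : (EuclideanSpace ℝ (Fin 3))) c ≤ R + ρ then (1 : ℝ) else 0))) := by
      have h1 : 0 ≤ ‖h q‖ ^ 2 * (if dist (q : (EuclideanSpace ℝ (Fin 3))) c ≤ R + ρ then (1 : ℝ) else 0) := by split_ifs <;> positivity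
      have h2 : 0 ≤ ‖h p‖ ^ 2 * (if dist (p : (EuclideanSpace ℝ (Fin 3))) c ≤ R + ρ then (1 : ℝ) else 0) := by split_ifs <;> positivity
      positivity
    have hBp0 : (0 : ℝ) ≤ (if dist (p : (EuclideanSpace ℝ (Fin 3))) c ≤ R then (1 : ℝ) else 0) := by split_ifs <;> norm_num
    have hBq0 : (0 : ℝ) ≤ (if dist (q : (EuclideanSpace ℝ (Fin 3))) c ≤ R then (1 : ℝ) else 0) := by split_ifs <;> norm_num
    by_cases hfar : ρ < d
    · -- far pairs
      rw [if_pos hfar]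
      have hind : (η p - η q) ^ 2 ≤ (if dist (p : (EuclideanSpace ℝ (Fin 3))) c ≤ R then (1 : ℝ) else 0) + (if dist (q : (EuclideanSpace ℝ (Fin 3))) c ≤ R then (1 : ℝ) else 0) := by
        by_cases hp' : dist (p : (EuclideanSpace ℝ (Fin 3))) c ≤ R
        · rw [if_pos hp']
          have h0p := hη0 p; have h1p := hη1 p; have h0q := hη0 q; have h1q := hη1 q
          nlinarith
        · by_cases hq' : dist (q : (EuclideanSpace ℝ (Fin 3))) c ≤ R
          · rw [if_neg hp', if_pos hq']
            have h0p := hη0 p; have h1p := hη1 p; have h0q := hη0 q; have h1q := hη1 q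
            nlinarith
          · rw [if_neg hp', if_neg hq', hηR p (lt_of_not_ge hp'), hηR q (lt_of_not_ge hq')]; norm_num
      have hhh : ‖h p‖ * ‖h q‖ ≤ B * B := mul_le_mul (hB _) (hB _) (norm_nonneg _) hB0
      have h8pos : 0 ≤ (d⁻¹) ^ 8 := by positivity
      calc (η p - η q) ^ 2 * |⟪((-((‖(p : (EuclideanSpace ℝ (Fin 3))) - q‖ ^ 2)⁻¹) ^ 7 + ((‖(p : (EuclideanSpace ℝ (Fin 3))) - q‖ ^ 2)⁻¹) ^ 4) • (h p) + (2 * ⟪(p : (EuclideanSpace ℝ (Fin 3))) - q, h p⟫ * (7 * ((‖(p : (EuclideanSpace ℝ (Fin 3))) - q‖ ^ 2)⁻¹) ^ 8 - 4 * ((‖(p : (EuclideanSpace ℝ (Fin 3))) - q‖ ^ 2)⁻¹) ^ 5)) • ((p : (EuclideanSpace ℝ (Fin 3))) - q)), h q⟫|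
          ≤ ((if dist (p : (EuclideanSpace ℝ (Fin 3))) c ≤ R then (1 : ℝ) else 0) + (if dist (q : (EuclideanSpace ℝ (Fin 3))) c ≤ R then (1 : ℝ) else 0)) * (38 * (d⁻¹) ^ 8 * ‖h p‖ * ‖h q‖) :=
            mul_le_mul hind hin (abs_nonneg _) (by positivity)
        _ = 38 * ((d⁻¹) ^ 8 * (‖h p‖ * ‖h q‖)) * ((if dist (p : (EuclideanSpace ℝ (Fin 3))) c ≤ R then (1 : ℝ) else 0) + (if dist (q : (EuclideanSpace ℝ (Fin 3))) c ≤ R then (1 : ℝ) else 0)) := by ring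
        _ ≤ 38 * ((d⁻¹) ^ 8 * (B * B)) * ((if dist (p : (EuclideanSpace ℝ (Fin 3))) c ≤ R then (1 : ℝ) else 0) + (if dist (q : (EuclideanSpace ℝ (Fin 3))) c ≤ R then (1 : ℝ) else 0)) := by gcongr
        _ = 38 * B ^ 2 * ((d⁻¹) ^ 8 * (if dist (p : (EuclideanSpace ℝ (Fin 3))) c ≤ R then (1 : ℝ) else 0) + (d⁻¹) ^ 8 * (if dist (q : (EuclideanSpace ℝ (Fin 3))) c ≤ R then (1 : ℝ) else 0)) := by ring
        _ ≤ _ := by linarith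
    · -- near pairs
      rw [if_neg hfar]
      have hdle : d ≤ ρ := le_of_not_gt hfar
      by_cases hηeq : η p = η q
      · rw [hηeq, sub_self]
        have : (0 : ℝ) ^ 2 * |⟪((-((‖(p : (EuclideanSpace ℝ (Fin 3))) - q‖ ^ 2)⁻¹) ^ 7 + ((‖(p : (EuclideanSpace ℝ (Fin 3))) - q‖ ^ 2)⁻¹) ^ 4) • (h p) + (2 * ⟪(p : (EuclideanSpace ℝ (Fin 3))) - q, h p⟫ * (7 * ((‖(p : (EuclideanSpace ℝ (Fin 3))) - q‖ ^ 2)⁻¹) ^ 8 - 4 * ((‖(p : (EuclideanSpace ℝ (Fin 3))) - q‖ ^ 2)⁻¹) ^ 5)) • ((p : (EuclideanSpace ℝ (Fin 3))) - q)), h q⟫| = 0 := by ring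
        rw [this]
        have : 0 ≤ 38 * B ^ 2 * (0 * (if dist (p : (EuclideanSpace ℝ (Fin 3))) c ≤ R then (1 : ℝ) else 0) + 0 * (if dist (q : (EuclideanSpace ℝ (Fin 3))) c ≤ R then (1 : ℝ) else 0)) := by positivity
        linarith
      · have hone : η p ≠ 0 ∨ η q ≠ 0 := by
          by_contra hcon
          push Not at hcon
          exact hηeq (by rw [hcon.1, hcon.2])
        have hnear : dist (p : (EuclideanSpace ℝ (Fin 3))) c ≤ R + ρ ∧ dist (q : (EuclideanSpace ℝ (Fin 3))) c ≤ R + ρ := by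
          rcases hone with h1 | h1
          · have hpR : dist (p : (EuclideanSpace ℝ (Fin 3))) c ≤ R := le_of_not_gt fun h' => h1 (hηR p h')
            refine ⟨by linarith, ?_⟩
            have := dist_triangle (q : (EuclideanSpace ℝ (Fin 3))) p c
            rw [hdqp] at this
            linarith
          · have hqR : dist (q : (EuclideanSpace ℝ (Fin 3))) c ≤ R := le_of_not_gt fun h' => h1 (hηR q h')
            refine ⟨?_, by linarith⟩
            have := dist_triangle (p : (EuclideanSpace ℝ (Fin 3))) q c
            rw [← hdd] at this
            linarith
        rw [if_pos hnear.1, if_pos hnear.2, mul_one, mul_one]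
        have hηsq : (η p - η q) ^ 2 ≤ d ^ 2 / ρ ^ 2 := by
          have h1 := hlip p q
          rw [hnd] at h1
          calc (η p - η q) ^ 2 = |η p - η q| ^ 2 := (sq_abs _).symm
            _ ≤ (d / ρ) ^ 2 := pow_le_pow_left₀ (abs_nonneg _) h1 2
            _ = d ^ 2 / ρ ^ 2 := by rw [div_pow]
        have hd6 : (d⁻¹) ^ 8 * d ^ 2 = (d⁻¹) ^ 6 := by field_simp
        have hprod : (η p - η q) ^ 2 * |⟪((-((‖(p : (EuclideanSpace ℝ (Fin 3))) - q‖ ^ 2)⁻¹) ^ 7 + ((‖(p : (EuclideanSpace ℝ (Fin 3))) - q‖ ^ 2)⁻¹) ^ 4) • (h p) + (2 * ⟪(p : (EuclideanSpace ℝ (Fin 3))) - q, h p⟫ * (7 * ((‖(p : (EuclideanSpace ℝ (Fin 3))) - q‖ ^ 2)⁻¹) ^ 8 - 4 * ((‖(p : (EuclideanSpace ℝ (Fin 3))) - q‖ ^ 2)⁻¹) ^ 5)) • ((p : (EuclideanSpace ℝ (Fin 3))) - q)), h q⟫| ≤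
            (d ^ 2 / ρ ^ 2) * (38 * (d⁻¹) ^ 8 * ‖h p‖ * ‖h q‖) :=
          mul_le_mul hηsq hin (abs_nonneg _) (by positivity)
        have hamgm : ‖h p‖ * ‖h q‖ ≤ (‖h p‖ ^ 2 + ‖h q‖ ^ 2) / 2 := by nlinarith [sq_nonneg (‖h p‖ - ‖h q‖)]
        have h6pos : 0 ≤ (d⁻¹) ^ 6 := by positivity
        have hfar0 : 0 ≤ 38 * B ^ 2 * (0 * (if dist (p : (EuclideanSpace ℝ (Fin 3))) c ≤ R then (1 : ℝ) else 0) + 0 * (if dist (q : (EuclideanSpace ℝ (Fin 3))) c ≤ R then (1 : ℝ) else 0)) := by positivity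
        calc (η p - η q) ^ 2 * |⟪((-((‖(p : (EuclideanSpace ℝ (Fin 3))) - q‖ ^ 2)⁻¹) ^ 7 + ((‖(p : (EuclideanSpace ℝ (Fin 3))) - q‖ ^ 2)⁻¹) ^ 4) • (h p) + (2 * ⟪(p : (EuclideanSpace ℝ (Fin 3))) - q, h p⟫ * (7 * ((‖(p : (EuclideanSpace ℝ (Fin 3))) - q‖ ^ 2)⁻¹) ^ 8 - 4 * ((‖(p : (EuclideanSpace ℝ (Fin 3))) - q‖ ^ 2)⁻¹) ^ 5)) • ((p : (EuclideanSpace ℝ (Fin 3))) - q)), h q⟫|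
            ≤ (d ^ 2 / ρ ^ 2) * (38 * (d⁻¹) ^ 8 * ‖h p‖ * ‖h q‖) := hprod
          _ = 38 / ρ ^ 2 * ((d⁻¹) ^ 8 * d ^ 2) * (‖h p‖ * ‖h q‖) := by ring
          _ = 38 / ρ ^ 2 * (d⁻¹) ^ 6 * (‖h p‖ * ‖h q‖) := by rw [hd6]
          _ ≤ 38 / ρ ^ 2 * (d⁻¹) ^ 6 * ((‖h p‖ ^ 2 + ‖h q‖ ^ 2) / 2) := by gcongr
          _ = 19 / ρ ^ 2 * ((d⁻¹) ^ 6 * ‖h q‖ ^ 2 + (d⁻¹) ^ 6 * ‖h p‖ ^ 2) := by ring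
          _ ≤ _ := by linarith


end

end Summit.AtomisticToContinuum.Crystallization.Theorems.ExcessDecayLiouville

end
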